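import Literature.Barriers.CriticalPhenomena.LaceExpansionNobleCoefficients
import Literature.Probability.Percolation.MagnetizationLowerBound
import HarnessLib

/-!
# [FvdH17] the `N = 0` NoBLE coefficient `Ψ^{(0),κ}` at the two neighbours `± e_κ` of the origin:
# `Ψ^{(0),κ}(e_κ) = 0` and `Ψ^{(0),κ}(-e_κ) > 0` in the orientation of the DEFINITIONS (3.24)/(3.42)

Source: R. Fitzner, R. van der Hofstad, *Mean-field behavior for nearest-neighbor percolation in `d > 10`*,
Electron. J. Probab. 22 (2017) no. 43 = arXiv:1506.07977v2 [FvdH17]; companion: *Generalized approach to the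
non-backtracking lace expansion*, Probab. Theory Relat. Fields 169 (2017) 1041–1119 [NoBLE17].

WHAT IS REPRODUCED, AND WHY.  [FvdH17] (3.24)/(3.42) (arXiv v2 pp. 25, 28; EJP p. 26) define
`Ψ^{(0),κ}(x) = (1-δ_{0,x})(p/μ_p) P_p({0 ⇔ x} ∩ {x - e_κ ∉ C̃^{(x,x-e_κ)}(0)})`: the far end ("top") of the NEXT
pivotal bond is `x - e_κ`.  This orientation is the one forced by the expansion identity (2.14)
`τ(x) = δ_{0,x} + μ_p Σ_{y,κ}(δ_{0,y} + Ψ^κ(y)) τ^κ(x - y + e_κ) + …` with `τ^κ = P^{e_κ}` ((2.12)), it is the one of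
[NoBLE17] (1.13) ("for percolation `G^ι_z` is the two-point function of the model defined on `ℤ^d ∖ {e_ι}`",
PTRF p. 1046), and it is the tree's (`Literature.Barriers.CriticalPhenomena.noblePsiBT`, for which (3.35) and
Prop. 2.1 are kernel theorems elsewhere in this directory).  The BOUNDING sections of [FvdH17] write the top as
`x + e_κ` instead ((4.46)–(4.47), arXiv v2 p. 39 = EJP p. 36, with the indicator `𝟙{x ∉ {-e_κ, e_κ}}`; (4.52) p. 40;
§6.1 (6.26)–(6.30) p. 61 "We can remove `x = -e_κ` from the sum as `Ψ^{(1),κ}_{R,I}(-e_κ) = 0`"; (6.40) p. 64;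
extended version App. B (B.37)–(B.53)), i.e. they bound the mirror image `Ψ_B^κ(x) = Ψ^κ(-x)`.  Summed over `x` the two
agree; the SPLIT I (region `‖x - e_κ‖₂ ≤ 1`, (3.62)) does not.  This module settles, in the kernel and for the
DEFINED objects, the two pointwise facts at the neighbours of the origin on which the two readings differ
(packet files of build `lace`: GAPS.md "G24", DIVERGENCE.md D53):

* `noblePsiT_zero_stepVec_self` / `noblePsiN_zero_stepVec_self`: **`Ψ^{(0),κ}(e_κ) = 0`** — at `x = e_κ` the top
  `x - e_κ = 0` is the starting point, which lies in its own restricted cluster (`self_mem_restrCluster`), so the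
  defining event is empty.  (The printed proof instead treats `x = e_κ` as carrying the `{0 ←3→ e_κ}∘{0 ←3→ e_κ}`
  term of (4.46) and removes `x = -e_κ`.)
* `noblePsiT_zero_neg_stepVec_pos`: **`(μ_p/p) Ψ^{(0),κ}(-e_κ) > 0`** for `0 < p < 1`, `d ≥ 2` — witnessed by the
  finite cylinder "the bond `(0,-e_κ)` and the three bonds of the path `0, u, u - e_κ, -e_κ` (`u = e_j`, `j ≠ |κ|`)
  occupied, the `2d` bonds at `-2e_κ` vacant": on it `0 ⇔ -e_κ` with no pivotal bond (every single bond can be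
  removed) and the top `-2e_κ` is isolated, hence not in `C̃^{(-e_κ,-2e_κ)}(0)`; its probability is
  `p⁴(1-p)^{|F|-4} > 0` (`bondPercolation_real_patternCyl`).  So `x = -e_κ` is NOT excluded from `Ψ^{(0),κ}` by
  anything in the definitions; its `{0 ←1̲→ x}∘{0 ←3→ x}` content lies outside the split-I region and hence in the
  remainder `Ψ^{(0),κ}_{R,I}` of (3.62) — the reading behind GAPS G24 (constant `(2d-1)` resp. `(2d-2)·p/μ_p` in place
  of the printed `(2d-2)` in the first term of (4.24) for the defined split).

Nothing here is a cited fact; the module has no hypotheses beyond `2 ≤ d`, `0 < p < 1`.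

## References

* [FvdH17] R. Fitzner, R. van der Hofstad, EJP 22 (2017) no. 43 (arXiv:1506.07977v2): (2.12)–(2.14) p. 10; (3.24) p. 25;
  (3.42) p. 28 (EJP p. 26); (3.60)–(3.62) p. 30 (EJP p. 28); Lemma 4.2 (4.24) p. 37 (EJP p. 34); (4.46)–(4.47) p. 39
  (EJP p. 36); (4.52) p. 40 (EJP p. 37); §6.1 (6.26)–(6.30) p. 61 (EJP p. 56); (6.40) p. 64 (EJP p. 58); extended
  version (arXiv:1506.07977v1) App. B (B.37)–(B.38) p. 81, (B.44)–(B.48) p. 82, (B.51)–(B.53) p. 83.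
* [NoBLE17] R. Fitzner, R. van der Hofstad, PTRF 169 (2017): (1.10)–(1.13) p. 1046; §4.1.1 p. 1081; (4.14) p. 1083.
* G. Grimmett, *Percolation*, 2nd ed. (Springer 1999), §1.3 (product measure, cylinder probabilities).
-/

noncomputable section

namespace Literature.Probability.FitznerVanDerHofstad2017

open _root_.MeasureTheory Literature.Barriers.CriticalPhenomena Literature.Probability.Percolation
open Literature.Probability.LatticeModels
open scoped ENNReal

variable {d : ℕ}

/-! ### A. Coordinates of the unit steps (local helpers) -/

section Helpers

/-- `e_κ = ± (0,…,1,…,0)`. [folklore] -/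
private theorem stepVec_eq_or (κ : Fin d × Bool) :
    stepVec κ = Pi.single κ.1 (1 : ℤ) ∨ stepVec κ = -Pi.single κ.1 (1 : ℤ) := by
  unfold Literature.Probability.Percolation.stepVec
  split_ifs <;> simp

/-- The `κ`-coordinate of `e_κ` is `± 1`, hence non-zero. [folklore] -/
private theorem stepVec_apply_fst_ne_zero (κ : Fin d × Bool) : stepVec κ κ.1 ≠ 0 := by
  rcases stepVec_eq_or κ with h | h <;> simp [h]

/-- The other coordinates of `e_κ` vanish. [folklore] -/
private theorem stepVec_apply_of_ne (κ : Fin d × Bool) {j : Fin d} (hj : j ≠ κ.1) : stepVec κ j = 0 := by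
  rcases stepVec_eq_or κ with h | h <;> simp [h, hj]

/-- `e_κ ≠ 0`. [folklore] -/
private theorem stepVec_ne_zero'' (κ : Fin d × Bool) : stepVec κ ≠ (0 : Site d) := fun h =>
  stepVec_apply_fst_ne_zero κ (by rw [h]; rfl)

/-- `0 ∼ e_κ` in `ℤ^d`. [folklore] -/
private theorem adj_zero_stepVec (κ : Fin d × Bool) : (zdGraph d).Adj 0 (stepVec κ) :=
  (zdGraph_adj_iff_stepVec 0 (stepVec κ)).2 ⟨κ, (zero_add _).symm⟩

/-- `x ∼ x + e_κ` in `ℤ^d`. [folklore] -/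
private theorem adj_add_stepVec (x : Site d) (κ : Fin d × Bool) : (zdGraph d).Adj x (x + stepVec κ) :=
  (zdGraph_adj_iff_stepVec x (x + stepVec κ)).2 ⟨κ, rfl⟩

/-- `x ∼ x - e_κ` in `ℤ^d`. [folklore] -/
private theorem adj_sub_stepVec (x : Site d) (κ : Fin d × Bool) : (zdGraph d).Adj x (x - stepVec κ) := by
  have h : (zdGraph d).Adj (x - stepVec κ) (x - stepVec κ + stepVec κ) := adj_add_stepVec (x - stepVec κ) κ
  rw [sub_add_cancel] at h
  exact h.symm

end Helpers

/-! ### B. `Ψ^{(0),κ}(e_κ) = 0` -/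

/-- **`(μ_p/p) Ψ^{(0),κ}_p(e_κ) = 0`**: with the top of the next pivotal bond at `x - e_κ` ((3.24)/(3.42)), the point
`x = e_κ` has top `0`, the starting point, which always lies in its own restricted cluster; so the event
`{0 ⇔ e_κ} ∩ {0 ∉ C̃^{(e_κ,0)}(0)}` is empty.  (In the mirrored orientation of the proof displays (4.46)–(4.47) it is
`x = -e_κ` that vanishes instead.) [cite: FitznerVanDerHofstad2017, (3.24) arXiv:1506.07977v2 p. 25; (3.42) arXiv:1506.07977v2 p. 28 = EJP p. 26; (4.46)–(4.47) arXiv:1506.07977v2 p. 39 = EJP p. 36] -/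
theorem noblePsiT_zero_stepVec_self (p : unitInterval) (κ : Fin d × Bool) :
    noblePsiT d p (stepVec κ) 0 (stepVec κ) = 0 := by
  rw [noblePsiT_of_ne (Or.inr (stepVec_ne_zero'' κ)), noblePsiBT_zero]
  refine measure_mono_null (fun ω hω => ?_) (measure_empty (μ := bondPercolation (zdGraph d) p))
  obtain ⟨-, -, h⟩ := hω
  rw [sub_self] at h
  exact h (self_mem_restrCluster _ _ _ _)

/-- **`Ψ^{(0),κ}_p(e_κ) = 0`** (real-valued, with the prefactor `p/μ_p`).
[cite: FitznerVanDerHofstad2017, (3.42) arXiv:1506.07977v2 p. 28 = EJP p. 26] -/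
theorem noblePsiN_zero_stepVec_self (p : unitInterval) (κ : Fin d × Bool) :
    noblePsiN d p (stepVec κ) 0 (stepVec κ) = 0 := by
  rw [noblePsiN_def, noblePsiT_zero_stepVec_self, ENNReal.toReal_zero, mul_zero]

/-! ### C. `Ψ^{(0),κ}(-e_κ) > 0` -/

/-- **`(μ_p/p) Ψ^{(0),κ}_p(-e_κ) > 0`** for `0 < p < 1` and `d ≥ 2`: in the orientation of (3.24)/(3.42) the point
`x = -e_κ` (top `-2e_κ`) is NOT excluded from the `N = 0` coefficient — the cylinder "`(0,-e_κ)`, `(0,u)`,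
`(u,u-e_κ)`, `(u-e_κ,-e_κ)` occupied (`u = e_j`, `j ≠ |κ|`), all `2d` bonds at `-2e_κ` vacant" lies in
`{0 ⇔ -e_κ} ∩ {-2e_κ ∉ C̃^{(-e_κ,-2e_κ)}(0)}` and has probability `p⁴(1-p)^{|F|-4} > 0`.  (The printed (4.47) drops
`x = -e_κ`; that is correct only in the mirrored orientation `x + e_κ` of §4.3/§6.1/App. B.)
[cite: FitznerVanDerHofstad2017, (3.24) arXiv:1506.07977v2 p. 25; (3.42) arXiv:1506.07977v2 p. 28 = EJP p. 26; (3.62) arXiv:1506.07977v2 p. 30 = EJP p. 28; (4.46)–(4.47) arXiv:1506.07977v2 p. 39 = EJP p. 36; (6.29)–(6.30) arXiv:1506.07977v2 p. 61 = EJP p. 56] -/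
theorem noblePsiT_zero_neg_stepVec_pos (hd : 2 ≤ d) (p : unitInterval) (hp0 : 0 < (p : ℝ))
    (hp1 : (p : ℝ) < 1) (κ : Fin d × Bool) :
    0 < noblePsiT d p (stepVec κ) 0 (-stepVec κ) := by
  classical
  -- a second coordinate direction
  obtain ⟨j, hj⟩ : ∃ j : Fin d, j ≠ κ.1 :=
    Fintype.exists_ne_of_one_lt_card (by simp only [Fintype.card_fin]; omega) κ.1
  set e : Site d := stepVec κ with he
  set u : Site d := stepVec (j, true) with hu
  -- coordinates
  have heκ : e κ.1 ≠ 0 := stepVec_apply_fst_ne_zero κ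
  have hej : e j = 0 := stepVec_apply_of_ne κ hj
  have huj : u j ≠ 0 := stepVec_apply_fst_ne_zero (j, true)
  have huκ : u κ.1 = 0 := stepVec_apply_of_ne (j, true) (Ne.symm hj)
  -- the distinctness facts
  have he0 : e ≠ 0 := stepVec_ne_zero'' κ
  have hne0 : -e ≠ 0 := neg_ne_zero.2 he0
  have hu0 : u ≠ 0 := stepVec_ne_zero'' (j, true)
  have hue : u ≠ e := fun h => huj (by rw [h]; exact hej)
  have hune : u ≠ -e := fun h => huj (by rw [h, Pi.neg_apply, hej, neg_zero])
  have hue0 : u - e ≠ 0 := sub_ne_zero.2 hue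
  have huene : u - e ≠ -e := fun h => hu0 (by simpa using h)
  have ht0 : -e - e ≠ 0 := by
    intro h
    have h' := congrFun h κ.1
    simp only [Pi.sub_apply, Pi.neg_apply, Pi.zero_apply] at h'
    omega
  have hte : -e - e ≠ -e := fun h => he0 (by simpa using h)
  have htu : -e - e ≠ u := by
    intro h
    have h' := congrFun h j
    simp only [Pi.sub_apply, Pi.neg_apply, hej, neg_zero, sub_zero] at h'
    exact huj h'.symm
  have htue : -e - e ≠ u - e := by
    intro h
    have h' : -e = u := by simpa using h
    exact hune h'.symm
  -- lattice adjacencies of the four bonds of the double connection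
  have hA1 : (zdGraph d).Adj 0 (-e) := by simpa using adj_sub_stepVec (0 : Site d) κ
  have hA2 : (zdGraph d).Adj 0 u := adj_zero_stepVec (j, true)
  have hA3 : (zdGraph d).Adj u (u - e) := adj_sub_stepVec u κ
  have hA4 : (zdGraph d).Adj (u - e) (-e) := by
    have h := (adj_add_stepVec (-e) (j, true)).symm
    rwa [show -e + u = u - e by abel] at h
  -- the bonds
  set b1 : Sym2 (Site d) := s(0, -e) with hb1
  set b2 : Sym2 (Site d) := s(0, u) with hb2
  set b3 : Sym2 (Site d) := s(u, u - e) with hb3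
  set b4 : Sym2 (Site d) := s(u - e, -e) with hb4
  have hb21 : b2 ≠ b1 := by
    rw [hb2, hb1, Ne, Sym2.eq_iff]; push Not
    exact ⟨fun _ => hune, fun h => absurd h.symm hne0⟩
  have hb31 : b3 ≠ b1 := by
    rw [hb3, hb1, Ne, Sym2.eq_iff]; push Not
    exact ⟨fun h => absurd h hu0, fun h => absurd h hune⟩
  have hb41 : b4 ≠ b1 := by
    rw [hb4, hb1, Ne, Sym2.eq_iff]; push Not
    exact ⟨fun h => absurd h hue0, fun h => absurd h huene⟩
  set O : Finset (Sym2 (Site d)) := {b1, b2, b3, b4} with hO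
  set N : Finset (Sym2 (Site d)) :=
    Finset.univ.image (fun a : Fin d × Bool => s(-e - e, -e - e + stepVec a)) with hN
  set F : Finset (Sym2 (Site d)) := O ∪ N with hF
  have hOF : O ⊆ F := Finset.subset_union_left
  -- every bond of `F` is a lattice bond
  have hFE : (↑F : Set (Sym2 (Site d))) ⊆ (zdGraph d).edgeSet := by
    intro b hb
    rw [Finset.mem_coe, hF, Finset.mem_union] at hb
    rcases hb with hb | hb
    · rw [hO] at hb
      simp only [Finset.mem_insert, Finset.mem_singleton] at hb
      rcases hb with rfl | rfl | rfl | rfl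
      · exact hA1
      · exact hA2
      · exact hA3
      · exact hA4
    · rw [hN, Finset.mem_image] at hb
      obtain ⟨a, -, rfl⟩ := hb
      exact adj_add_stepVec (-e - e) a
  -- the bonds at `-2e` are not among `b1, …, b4`
  have hNO : ∀ a : Fin d × Bool, s(-e - e, -e - e + stepVec a) ∉ O := by
    intro a ha
    rw [hO] at ha
    simp only [Finset.mem_insert, Finset.mem_singleton] at ha
    rcases ha with h | h | h | h
    · rw [hb1, Sym2.eq_iff] at h
      rcases h with ⟨h, -⟩ | ⟨h, -⟩
      · exact ht0 h
      · exact hte h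
    · rw [hb2, Sym2.eq_iff] at h
      rcases h with ⟨h, -⟩ | ⟨h, -⟩
      · exact ht0 h
      · exact htu h
    · rw [hb3, Sym2.eq_iff] at h
      rcases h with ⟨h, -⟩ | ⟨h, -⟩
      · exact htu h
      · exact htue h
    · rw [hb4, Sym2.eq_iff] at h
      rcases h with ⟨h, -⟩ | ⟨h, -⟩
      · exact htue h
      · exact hte h
  -- the event of the coefficient, as it stands after unfolding
  set S : Set (BondConfig (Site d)) := {ω | s(-e, -e - e) ∉ (∅ : Set (Sym2 (Site d))) ∧
      offBonds ∅ ω ∈ laceE {0} 0 (-e) ∧ -e - e ∉ restrCluster (-e) (-e - e) 0 (offBonds ∅ ω)} with hS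
  have hval : noblePsiT d p e 0 (-e) = bondPercolation (zdGraph d) p S := by
    rw [noblePsiT_of_ne (Or.inr hne0), noblePsiBT_zero]
  -- the cylinder lies in the event, up to the null set of non-lattice configurations
  have hincl : patternCyl F O ⊆ S ∪ {ω | ¬ ω ⊆ (zdGraph d).edgeSet} := by
    intro ω hω
    by_cases hωE : ω ⊆ (zdGraph d).edgeSet
    swap
    · exact Or.inr hωE
    left
    rw [mem_patternCyl] at hω
    have hopen : ∀ b ∈ O, b ∈ ω := fun b hb => (hω b (hOF hb)).2 hb
    have h1 : b1 ∈ ω := hopen b1 (by simp [hO])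
    have h2 : b2 ∈ ω := hopen b2 (by simp [hO])
    have h3 : b3 ∈ ω := hopen b3 (by simp [hO])
    have h4 : b4 ∈ ω := hopen b4 (by simp [hO])
    have hclosed : ∀ a : Fin d × Bool, s(-e - e, -e - e + stepVec a) ∉ ω := by
      intro a ha
      have hbF : s(-e - e, -e - e + stepVec a) ∈ F := by
        rw [hF, Finset.mem_union, hN, Finset.mem_image]
        exact Or.inr ⟨a, Finset.mem_univ a, rfl⟩
      exact hNO a ((hω _ hbF).1 ha)
    -- `0 ↔ -e` survives the removal of any single bond
    have hrob : ∀ b : Sym2 (Site d), (openGraph (ω \ {b})).Reachable 0 (-e) := by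
      intro b
      by_cases hb : b = b1
      · -- use the three-bond path `0, u, u - e, -e`
        have a2 : (openGraph (ω \ {b})).Adj 0 u :=
          (openGraph_adj _ _ _).2 ⟨⟨h2, fun h => hb21 (hb2.trans ((Set.mem_singleton_iff.1 h).trans hb))⟩, hA2.ne⟩
        have a3 : (openGraph (ω \ {b})).Adj u (u - e) :=
          (openGraph_adj _ _ _).2 ⟨⟨h3, fun h => hb31 (hb3.trans ((Set.mem_singleton_iff.1 h).trans hb))⟩, hA3.ne⟩
        have a4 : (openGraph (ω \ {b})).Adj (u - e) (-e) :=
          (openGraph_adj _ _ _).2 ⟨⟨h4, fun h => hb41 (hb4.trans ((Set.mem_singleton_iff.1 h).trans hb))⟩, hA4.ne⟩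
        exact ⟨SimpleGraph.Walk.cons a2 (SimpleGraph.Walk.cons a3 (SimpleGraph.Walk.cons a4 SimpleGraph.Walk.nil))⟩
      · -- use the direct bond
        have a1 : (openGraph (ω \ {b})).Adj 0 (-e) :=
          (openGraph_adj _ _ _).2 ⟨⟨h1, fun h => hb ((Set.mem_singleton_iff.1 h).symm.trans hb1.symm)⟩, hA1.ne⟩
        exact a1.reachable
    refine ⟨fun h => h, ?_, ?_⟩
    · -- `ω ∈ E'(0,-e;{0})`: connected (through `{0}`, trivially) and no pivotal bond
      rw [offBonds_empty, mem_laceE_iff]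
      refine ⟨?_, fun u' v' hpiv _ => ?_⟩
      · rw [mem_connThrough_iff]
        refine ⟨?_, ?_⟩
        · have a1 : (openGraph ω).Adj 0 (-e) := (openGraph_adj _ _ _).2 ⟨h1, hA1.ne⟩
          exact a1.reachable
        · rintro ⟨hx, -, -⟩
          exact hx rfl
      · obtain ⟨-, -, hin⟩ := hpiv
        obtain ⟨-, hy, -⟩ := hin
        exact hy ((mem_restrCluster_iff _ _ _ _ _).2 (hrob _))
    · -- the top `-2e` is isolated, hence not in the restricted cluster of `0`
      rw [offBonds_empty, mem_restrCluster_iff]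
      intro hreach
      obtain ⟨q⟩ := hreach.symm
      obtain ⟨c, hadj, -, -⟩ := q.exists_eq_cons_of_ne ht0
      obtain ⟨hcω, hcne⟩ := (openGraph_adj _ _ _).1 hadj
      have hcω' : s(-e - e, c) ∈ ω := hcω.1
      have hlat : (zdGraph d).Adj (-e - e) c := by
        have := hωE hcω'
        rwa [SimpleGraph.mem_edgeSet] at this
      obtain ⟨a, rfl⟩ := (zdGraph_adj_iff_stepVec _ _).1 hlat
      exact hclosed a hcω'
  -- the cylinder has positive probability
  have hcyl : 0 < bondPercolation (zdGraph d) p (patternCyl F O) := by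
    have hreal : 0 < (bondPercolation (zdGraph d) p).real (patternCyl F O) := by
      rw [bondPercolation_real_patternCyl (zdGraph d) p hFE hOF]
      exact mul_pos (pow_pos hp0 _) (pow_pos (by linarith) _)
    rw [measureReal_def] at hreal
    exact (ENNReal.toReal_pos_iff.1 hreal).1
  -- conclusion
  rw [hval]
  calc (0 : ℝ≥0∞) < bondPercolation (zdGraph d) p (patternCyl F O) := hcyl
    _ ≤ bondPercolation (zdGraph d) p (S ∪ {ω | ¬ ω ⊆ (zdGraph d).edgeSet}) := measure_mono hincl
    _ ≤ bondPercolation (zdGraph d) p S + bondPercolation (zdGraph d) p {ω | ¬ ω ⊆ (zdGraph d).edgeSet} :=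
        measure_union_le _ _
    _ = bondPercolation (zdGraph d) p S := by rw [bondPercolation_notSubset_edgeSet, add_zero]

/-- **Contrast of the two orientations at the unit vectors, packaged**: for `0 < p < 1`, `d ≥ 2`, the `N = 0`
coefficient of (3.42) vanishes at `e_κ` and not at `-e_κ` — the opposite of the pattern the proof displays
(4.46)–(4.47) / (6.29)–(6.30) assume. [cite: FitznerVanDerHofstad2017, (3.42) arXiv:1506.07977v2 p. 28 = EJP p. 26; (4.46)–(4.47) arXiv:1506.07977v2 p. 39 = EJP p. 36] -/
theorem noblePsiT_zero_stepVec_self_lt_neg (hd : 2 ≤ d) (p : unitInterval) (hp0 : 0 < (p : ℝ))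
    (hp1 : (p : ℝ) < 1) (κ : Fin d × Bool) :
    noblePsiT d p (stepVec κ) 0 (stepVec κ) < noblePsiT d p (stepVec κ) 0 (-stepVec κ) := by
  rw [noblePsiT_zero_stepVec_self]
  exact noblePsiT_zero_neg_stepVec_pos hd p hp0 hp1 κ

end Literature.Probability.FitznerVanDerHofstad2017
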